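import Mathlib
import Literature.Computability.AlgebraicComplexity.LinSubst
import Summits.ValiantsHypothesis.ValiantsHypothesis.Theorems.BorderApolarityToricWitnessObstructionQPStubStabTorus

/-!
# Border apolarity, crux `ToricWitnessObstructionQP` (stmt-ValiantsHypothesis-14753) — line `Sketch`,
# reshape 4: the CLEAN form of the Borel stability (SB) — a conjugate Borel of `GL(unused)` acts on
# the unused variables alone

Route `ValiantsHypothesis/BorderApolarity`, crux item `stmt-ValiantsHypothesis-14753`, line `Sketch`
(lead c3).  Write `σ := Fin m × Fin m`, `ess a := (m - n ≤ a.1 ∧ m - n ≤ a.2) ∨ a = (0,0)` ("own"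
variables: the block and `ℓ = (0,0)`), the others being "unused".  The residual stub
`stub_noStableNormalFormQP` of `Lines/Sketch.lean` carries the Borel part of the stabilities of the
initial spans `J' k` in RAW form:

* (P1) the own columns of `q` are coordinate vectors;
* (SB) `J' k` (`k ≤ m`) is stable under `linSubst ((q⁻¹ L q)ᵀ)` for every invertible `L` whose own
  columns are coordinate and whose unused block is triangular for the order `rk`;
* (SH) `J' k` is stable under `linSubst (1 + C)` for every `C` supported on unused rows × own columns.

This file CLEANS (SB).  Call `Y` the *clean part* of a matrix `X` when `Y` has coordinate own
columns, vanishes on own rows × unused columns and agrees with `X` on the unused block.  If the own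
columns of `X` are coordinate then `X = Y * (1 + E)` with `E` the own-rows × unused-columns block of
`X` (`cleanSB_factor`), `E * E = 0`, so `Xᵀ = (1 + Eᵀ) * Yᵀ` and the unipotent factor is removed by
(SH) (`cleanSB_reduction`, as in `stabTorus_reduction`).  Clean parts are multiplicative
(`cleanSB_mul`).  Consequence (`snf_stab_cleanBorel`): with `R` the clean part of `q` (invertible,
block-diagonal `1_own ⊕ q_ZZ`), every `J' k` is stable under `linSubst ((R⁻¹ L₀ R)ᵀ)` for every
invertible BLOCK-DIAGONAL `L₀ = 1_own ⊕ L_ZZ` with `rk`-triangular `L_ZZ` — the `q_ZZ`-conjugate of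
the full `rk`-Borel subgroup of `GL(unused)`, torus included, acting on the unused variables only; in
particular (`snf_stab_unusedTorus`) under the `q_ZZ`-conjugate of the FULL diagonal torus of the
unused variables (rank `m² - n² - 1`), which upgrades the one-parameter clean scaling (SZ) of
`stub_stabScalarBorel`.  Together with the clean pattern torus (ST) on the own variables, each `J' k`
is thus a module for a torus of rank `2n - 1 + (m² - n² - 1)` and for a maximal unipotent subgroup of
`GL(unused)` normalised by it: in coordinates adapted to that torus every `J' k` (and its apolar dual
`M_k = in_w(span of k × k minors)`) is spanned by elements `(own form) · (monomial in the unused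
variables)`.
-/

open MvPolynomial
open scoped BigOperators Matrix
open Literature.Computability.AlgebraicComplexity

-- the mandated summit-side namespace repeats a component by design (single-problem summit)
set_option linter.dupNamespace false

namespace Summit.ValiantsHypothesis.ValiantsHypothesis.Theorems.BorderApolarityToricWitnessObstructionQP

section Generic

variable {σ : Type*} [Fintype σ] [DecidableEq σ] (ess : σ → Prop)

/-- **The factorisation `X = Y * (1 + E)`**: `X` with coordinate `ess`-columns, `Y` its clean part
(coordinate `ess`-columns, zero on `ess`-rows × `¬ess`-columns, equal to `X` on the `¬ess` block), `E`
the `ess`-rows × `¬ess`-columns block of `X`. [folklore] -/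
theorem cleanSB_factor [DecidablePred ess] {X Y : Matrix σ σ ℂ}
    (hX : ∀ a, ess a → ∀ b, X b a = if b = a then 1 else 0)
    (hYo : ∀ a, ess a → ∀ b, Y b a = if b = a then 1 else 0)
    (hYc : ∀ b a, ess b → ¬ ess a → Y b a = 0)
    (hYu : ∀ b a, ¬ ess b → ¬ ess a → Y b a = X b a) :
    X = Y * (1 + Matrix.of fun b a => if ess b ∧ ¬ ess a then X b a else 0) := by
  ext b a
  rw [Matrix.mul_add, Matrix.mul_one, Matrix.add_apply, Matrix.mul_apply]
  simp only [Matrix.of_apply]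
  by_cases ha : ess a
  · have hc : ∀ i, (if ess i ∧ ¬ ess a then X i a else 0) = 0 := fun i => if_neg fun h => h.2 ha
    simp_rw [hc, mul_zero, Finset.sum_const_zero, add_zero]
    rw [hX a ha b, hYo a ha b]
  · by_cases hb : ess b
    · have h2 : ∑ i, Y b i * (if ess i ∧ ¬ ess a then X i a else 0) = X b a := by
        rw [Finset.sum_eq_single b]
        · rw [hYo b hb b, if_pos rfl, one_mul, if_pos ⟨hb, ha⟩]
        · intro i _ hib
          by_cases hi : ess i
          · rw [hYo i hi b, if_neg (Ne.symm hib), zero_mul]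
          · rw [if_neg fun h => hi h.1, mul_zero]
        · intro h; exact (h (Finset.mem_univ b)).elim
      rw [h2, hYc b a hb ha, zero_add]
    · have h2 : ∑ i, Y b i * (if ess i ∧ ¬ ess a then X i a else 0) = 0 := by
        refine Finset.sum_eq_zero fun i _ => ?_
        by_cases hi : ess i
        · rw [hYo i hi b, if_neg, zero_mul]
          rintro rfl
          exact hb hi
        · rw [if_neg fun h => hi h.1, mul_zero]
      rw [h2, add_zero, hYu b a hb ha]

/-- **Removing the unipotent factor.**  With Hom-stability of `J'` (stability under `linSubst (1 + C)`
for every `C` supported on `¬ess`-rows × `ess`-columns): if the `ess`-columns of `X` are coordinate,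
`Y` is the clean part of `X` and `linSubst Xᵀ D ∈ J' k`, then `linSubst Yᵀ D ∈ J' k`. [folklore] -/
theorem cleanSB_reduction [DecidablePred ess] (J' : ℕ → Set (MvPolynomial σ ℂ)) (m : ℕ)
    (hSH : ∀ C : Matrix σ σ ℂ, (∀ j i, C j i ≠ 0 → ¬ ess j ∧ ess i) →
      ∀ k ≤ m, ∀ D ∈ J' k, linSubst σ ℂ (1 + C) D ∈ J' k)
    {X Y : Matrix σ σ ℂ} (hX : ∀ a, ess a → ∀ b, X b a = if b = a then 1 else 0)
    (hYo : ∀ a, ess a → ∀ b, Y b a = if b = a then 1 else 0)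
    (hYc : ∀ b a, ess b → ¬ ess a → Y b a = 0)
    (hYu : ∀ b a, ¬ ess b → ¬ ess a → Y b a = X b a)
    (k : ℕ) (hk : k ≤ m) (D : MvPolynomial σ ℂ) (hmem : linSubst σ ℂ Xᵀ D ∈ J' k) :
    linSubst σ ℂ Yᵀ D ∈ J' k := by
  set E : Matrix σ σ ℂ := Matrix.of fun b a => if ess b ∧ ¬ ess a then X b a else 0 with hEdef
  have hE : ∀ b a, E b a ≠ 0 → ess b ∧ ¬ ess a := by
    intro b a h
    by_contra hne
    exact h (by rw [hEdef, Matrix.of_apply, if_neg hne])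
  have hEE : E * E = 0 := stabTorus_mul_self_eq_zero ess E hE
  have hEtEt : Eᵀ * Eᵀ = 0 := by
    rw [← Matrix.transpose_mul, hEE, Matrix.transpose_zero]
  have htr : Xᵀ = (1 + Eᵀ) * Yᵀ := by
    conv_lhs => rw [cleanSB_factor ess hX hYo hYc hYu]
    rw [Matrix.transpose_mul, Matrix.transpose_add, Matrix.transpose_one]
  rw [htr, linSubst_mul, AlgHom.comp_apply] at hmem
  have hC : ∀ j i, (-Eᵀ) j i ≠ 0 → ¬ ess j ∧ ess i := fun j i h => by
    rw [Matrix.neg_apply, Matrix.transpose_apply, neg_ne_zero] at h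
    exact ⟨(hE i j h).2, (hE i j h).1⟩
  have h2 := hSH (-Eᵀ) hC k hk _ hmem
  rwa [stabTorus_linSubst_cancel Eᵀ hEtEt] at h2

/-- **Conjugation keeps coordinate own columns.**  If `Pi * P = 1` and the `ess`-columns of `P` and
of `L` are coordinate vectors, then so are the `ess`-columns of `Pi * L * P`. [folklore] -/
theorem cleanSB_conj_ownCol {P Pi L : Matrix σ σ ℂ} (hPiP : Pi * P = 1)
    (hPcol : ∀ a, ess a → ∀ b, P b a = if b = a then 1 else 0)
    (hLcol : ∀ a, ess a → ∀ b, L b a = if b = a then 1 else 0) :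
    ∀ a, ess a → ∀ b, (Pi * L * P) b a = if b = a then 1 else 0 := by
  have hPicol := stabTorus_inv_col ess P Pi hPiP hPcol
  intro a ha b
  rw [Matrix.mul_apply]
  simp_rw [hPcol a ha, mul_ite, mul_one, mul_zero, Finset.sum_ite_eq', Finset.mem_univ, if_true,
    Matrix.mul_apply]
  simp_rw [hLcol a ha, mul_ite, mul_one, mul_zero, Finset.sum_ite_eq', Finset.mem_univ, if_true]
  exact hPicol a ha b

/-- **Products of matrices with coordinate own columns** have coordinate own columns. [folklore] -/
theorem cleanSB_mul_ownCol {X X' : Matrix σ σ ℂ}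
    (hX : ∀ a, ess a → ∀ b, X b a = if b = a then 1 else 0)
    (hX' : ∀ a, ess a → ∀ b, X' b a = if b = a then 1 else 0) :
    ∀ a, ess a → ∀ b, (X * X') b a = if b = a then 1 else 0 := by
  intro a ha b
  rw [Matrix.mul_apply]
  simp_rw [hX' a ha, mul_ite, mul_one, mul_zero, Finset.sum_ite_eq', Finset.mem_univ, if_true]
  exact hX a ha b

/-- **Clean parts are multiplicative.**  If `X` has coordinate `ess`-columns and `Y`, `Y'` are the
clean parts of `X`, `X'`, then `Y * Y'` is the clean part of `X * X'` (coordinate own columns, zero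
corner, and the unused block of `X * X'`). [folklore] -/
theorem cleanSB_mul {X X' Y Y' : Matrix σ σ ℂ}
    (hX : ∀ a, ess a → ∀ b, X b a = if b = a then 1 else 0)
    (hYo : ∀ a, ess a → ∀ b, Y b a = if b = a then 1 else 0)
    (hYc : ∀ b a, ess b → ¬ ess a → Y b a = 0)
    (hYu : ∀ b a, ¬ ess b → ¬ ess a → Y b a = X b a)
    (hYo' : ∀ a, ess a → ∀ b, Y' b a = if b = a then 1 else 0)
    (hYc' : ∀ b a, ess b → ¬ ess a → Y' b a = 0)
    (hYu' : ∀ b a, ¬ ess b → ¬ ess a → Y' b a = X' b a) :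
    (∀ a, ess a → ∀ b, (Y * Y') b a = if b = a then 1 else 0) ∧
    (∀ b a, ess b → ¬ ess a → (Y * Y') b a = 0) ∧
    (∀ b a, ¬ ess b → ¬ ess a → (Y * Y') b a = (X * X') b a) := by
  refine ⟨cleanSB_mul_ownCol ess hYo hYo', ?_, ?_⟩
  · intro b a hb ha
    rw [Matrix.mul_apply]
    refine Finset.sum_eq_zero fun i _ => ?_
    by_cases hi : ess i
    · rw [hYc' i a hi ha, mul_zero]
    · rw [hYc b i hb hi, zero_mul]
  · intro b a hb ha
    rw [Matrix.mul_apply, Matrix.mul_apply]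
    refine Finset.sum_congr rfl fun i _ => ?_
    by_cases hi : ess i
    · -- `Y b i = δ_{bi} = 0 = X b i` (`b` unused, `i` own)
      have hbi : b ≠ i := by rintro rfl; exact hb hi
      rw [hYo i hi b, hX i hi b, if_neg hbi, zero_mul, zero_mul]
    · rw [hYu b i hb hi, hYu' i a hi ha]

omit [Fintype σ] in
/-- Every matrix HAS a clean part. [folklore] -/
theorem cleanSB_exists [DecidablePred ess] (X : Matrix σ σ ℂ) : ∃ Y : Matrix σ σ ℂ,
    (∀ a, ess a → ∀ b, Y b a = if b = a then 1 else 0) ∧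
    (∀ b a, ess b → ¬ ess a → Y b a = 0) ∧
    (∀ b a, ¬ ess b → ¬ ess a → Y b a = X b a) := by
  refine ⟨Matrix.of fun b a => if ess a then (if b = a then 1 else 0) else (if ess b then 0 else X b a),
    ?_, ?_, ?_⟩
  · intro a ha b
    rw [Matrix.of_apply, if_pos ha]
  · intro b a hb ha
    rw [Matrix.of_apply, if_neg ha, if_pos hb]
  · intro b a hb ha
    rw [Matrix.of_apply, if_neg ha, if_neg hb]

omit [Fintype σ] in
/-- A clean part is determined by its three defining properties. [folklore] -/
theorem cleanSB_unique {X Y Y' : Matrix σ σ ℂ}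
    (hYo : ∀ a, ess a → ∀ b, Y b a = if b = a then 1 else 0)
    (hYc : ∀ b a, ess b → ¬ ess a → Y b a = 0)
    (hYu : ∀ b a, ¬ ess b → ¬ ess a → Y b a = X b a)
    (hYo' : ∀ a, ess a → ∀ b, Y' b a = if b = a then 1 else 0)
    (hYc' : ∀ b a, ess b → ¬ ess a → Y' b a = 0)
    (hYu' : ∀ b a, ¬ ess b → ¬ ess a → Y' b a = X b a) : Y = Y' := by
  ext b a
  by_cases ha : ess a
  · rw [hYo a ha b, hYo' a ha b]
  · by_cases hb : ess b
    · rw [hYc b a hb ha, hYc' b a hb ha]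
    · rw [hYu b a hb ha, hYu' b a hb ha]

end Generic

/-! ## The clean Borel stability for the residual's data -/

/-- **Clean Borel stability (lead c3).**  Let the own columns of `q` be coordinate vectors (P1), let
`J'` satisfy the raw Borel clause (SB) of `stub_noStableNormalFormQP` (stability of each `J' k`,
`k ≤ m`, under `linSubst ((q⁻¹ L q)ᵀ)` for every invertible `L` with coordinate own columns and
`rk`-triangular unused block) and the Hom clause (SH).  Then there is an invertible BLOCK-DIAGONAL
matrix `R` (coordinate own columns, zero own-rows × unused-columns corner, unused block equal to that
of `q`) such that each `J' k` is stable under `linSubst ((R⁻¹ L₀ R)ᵀ)` for every invertible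
block-diagonal `L₀` (coordinate own columns, zero corner) with `rk`-triangular unused block: the
`q_ZZ`-conjugate of the `rk`-Borel subgroup of `GL(unused)`, acting on the unused variables alone.
[folklore] -/
theorem snf_stab_cleanBorel : ∀ (n m : ℕ) [NeZero m] (q : GL (Fin m × Fin m) ℂ)
    (J' : ℕ → Set (MvPolynomial (Fin m × Fin m) ℂ)),
    (∀ a : Fin m × Fin m, ((m - n ≤ (a.1 : ℕ) ∧ m - n ≤ (a.2 : ℕ)) ∨ a = (0, 0)) →
      ∀ b : Fin m × Fin m, (q : Matrix (Fin m × Fin m) (Fin m × Fin m) ℂ) b a = if b = a then 1 else 0) →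
    (∀ L : Matrix.GeneralLinearGroup (Fin m × Fin m) ℂ,
      let M : Matrix (Fin m × Fin m) (Fin m × Fin m) ℂ := L ;
      let ess := fun a : Fin m × Fin m => (m - n ≤ (a.1 : ℕ) ∧ m - n ≤ (a.2 : ℕ)) ∨ a = (0, 0) ;
      let rk := fun (a : Fin m × Fin m) => (if ess a then 0 else m * m) + ((a.1 : ℕ) * m + (a.2 : ℕ)) ;
      (∀ a, ess a → ∀ b, M b a = if b = a then 1 else 0) →
      (∀ i j, ¬ ess i → ¬ ess j → M j i ≠ 0 → rk j ≤ rk i) →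
      ∀ k ≤ m, ∀ D ∈ J' k,
        linSubst (Fin m × Fin m) ℂ (((q⁻¹ : GL (Fin m × Fin m) ℂ) : Matrix (Fin m × Fin m) (Fin m × Fin m) ℂ) *
          M * (q : Matrix (Fin m × Fin m) (Fin m × Fin m) ℂ))ᵀ D ∈ J' k) →
    (∀ C : Matrix (Fin m × Fin m) (Fin m × Fin m) ℂ,
      (∀ j i : Fin m × Fin m, C j i ≠ 0 →
        ¬ (((m - n ≤ (j.1 : ℕ) ∧ m - n ≤ (j.2 : ℕ)) ∨ j = (0, 0))) ∧
          (((m - n ≤ (i.1 : ℕ) ∧ m - n ≤ (i.2 : ℕ)) ∨ i = (0, 0)))) →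
      ∀ k ≤ m, ∀ D ∈ J' k, linSubst (Fin m × Fin m) ℂ (1 + C) D ∈ J' k) →
    ∃ R : GL (Fin m × Fin m) ℂ,
      let ess := fun a : Fin m × Fin m => (m - n ≤ (a.1 : ℕ) ∧ m - n ≤ (a.2 : ℕ)) ∨ a = (0, 0) ;
      let rk := fun (a : Fin m × Fin m) => (if ess a then 0 else m * m) + ((a.1 : ℕ) * m + (a.2 : ℕ)) ;
      (∀ a, ess a → ∀ b, (R : Matrix (Fin m × Fin m) (Fin m × Fin m) ℂ) b a = if b = a then 1 else 0) ∧
      (∀ b a, ess b → ¬ ess a → (R : Matrix (Fin m × Fin m) (Fin m × Fin m) ℂ) b a = 0) ∧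
      (∀ b a, ¬ ess b → ¬ ess a → (R : Matrix (Fin m × Fin m) (Fin m × Fin m) ℂ) b a =
        (q : Matrix (Fin m × Fin m) (Fin m × Fin m) ℂ) b a) ∧
      ∀ L₀ : Matrix.GeneralLinearGroup (Fin m × Fin m) ℂ,
        let M : Matrix (Fin m × Fin m) (Fin m × Fin m) ℂ := L₀ ;
        (∀ a, ess a → ∀ b, M b a = if b = a then 1 else 0) →
        (∀ b a, ess b → ¬ ess a → M b a = 0) →
        (∀ i j, ¬ ess i → ¬ ess j → M j i ≠ 0 → rk j ≤ rk i) →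
        ∀ k ≤ m, ∀ D ∈ J' k,
          linSubst (Fin m × Fin m) ℂ (((R⁻¹ : GL (Fin m × Fin m) ℂ) : Matrix (Fin m × Fin m) (Fin m × Fin m) ℂ) *
            M * (R : Matrix (Fin m × Fin m) (Fin m × Fin m) ℂ))ᵀ D ∈ J' k := by
  intro n m _ q J' hP1 hSB hSH
  classical
  set ess : Fin m × Fin m → Prop := fun a => (m - n ≤ (a.1 : ℕ) ∧ m - n ≤ (a.2 : ℕ)) ∨ a = (0, 0)
    with hess
  -- the clean parts `Rq` of `q` and `Rqi` of `q⁻¹`; they are mutually inverse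
  obtain ⟨Rq, hRo, hRc, hRu⟩ := cleanSB_exists ess (q : Matrix (Fin m × Fin m) (Fin m × Fin m) ℂ)
  obtain ⟨Rqi, hRio, hRic, hRiu⟩ :=
    cleanSB_exists ess (((q⁻¹ : GL (Fin m × Fin m) ℂ) : Matrix (Fin m × Fin m) (Fin m × Fin m) ℂ))
  have hqicol : ∀ a, ess a → ∀ b,
      (((q⁻¹ : GL (Fin m × Fin m) ℂ) : Matrix (Fin m × Fin m) (Fin m × Fin m) ℂ)) b a =
        if b = a then 1 else 0 :=
    stabTorus_inv_col ess _ _ q.inv_mul hP1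
  have hone : (∀ a, ess a → ∀ b, (1 : Matrix (Fin m × Fin m) (Fin m × Fin m) ℂ) b a = if b = a then 1 else 0) ∧
      (∀ b a, ess b → ¬ ess a → (1 : Matrix (Fin m × Fin m) (Fin m × Fin m) ℂ) b a = 0) := by
    refine ⟨fun a _ b => by rw [Matrix.one_apply], fun b a hb ha => ?_⟩
    rw [Matrix.one_apply, if_neg]
    rintro rfl
    exact ha hb
  have hmul1 : Rq * Rqi = 1 := by
    obtain ⟨h1, h2, h3⟩ := cleanSB_mul ess hP1 hRo hRc hRu hRio hRic hRiu
    rw [q.mul_inv] at h3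
    exact cleanSB_unique ess h1 h2 h3 hone.1 hone.2 (fun _ _ _ _ => rfl)
  have hmul2 : Rqi * Rq = 1 := by
    obtain ⟨h1, h2, h3⟩ := cleanSB_mul ess hqicol hRio hRic hRiu hRo hRc hRu
    rw [q.inv_mul] at h3
    exact cleanSB_unique ess h1 h2 h3 hone.1 hone.2 (fun _ _ _ _ => rfl)
  let R : GL (Fin m × Fin m) ℂ := ⟨Rq, Rqi, hmul1, hmul2⟩
  refine ⟨R, ?_⟩
  intro ess' rk
  refine ⟨hRo, hRc, hRu, ?_⟩
  intro L₀ M hLo hLc hLtri k hk D hD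
  -- raw stability of `(q⁻¹ L₀ q)ᵀ`
  have hmem := hSB L₀ hLo hLtri k hk D hD
  -- `Rqi * L₀ * Rq` is the clean part of `q⁻¹ * L₀ * q`
  obtain ⟨h1, h2, h3⟩ := cleanSB_mul ess hqicol hRio hRic hRiu hLo hLc (fun _ _ _ _ => rfl)
  obtain ⟨h1', h2', h3'⟩ := cleanSB_mul ess (cleanSB_mul_ownCol ess hqicol hLo) h1 h2 h3 hRo hRc hRu
  have hX := cleanSB_conj_ownCol ess q.inv_mul hP1 hLo
  have hres := cleanSB_reduction ess J' m hSH hX h1' h2' h3' k hk D hmem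
  -- `R⁻¹ = Rqi`
  have hRinv : ((R⁻¹ : GL (Fin m × Fin m) ℂ) : Matrix (Fin m × Fin m) (Fin m × Fin m) ℂ) = Rqi := rfl
  rw [hRinv]
  exact hres

/-- **The full unused torus acts (lead c3).**  Under (P1), (SB) and (SH) as in `snf_stab_cleanBorel`,
with the block-diagonal `R` given there: each `J' k` (`k ≤ m`) is stable under
`linSubst ((R⁻¹ · diag d · R)ᵀ)` for every `d` with `d = 1` on the own variables and `d ≠ 0`
everywhere — the `q_ZZ`-conjugate of the FULL diagonal torus of the unused variables, of rank
`m² - n² - 1`, acting on the unused variables alone. [folklore] -/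
theorem snf_stab_unusedTorus : ∀ (n m : ℕ) [NeZero m] (q : GL (Fin m × Fin m) ℂ)
    (J' : ℕ → Set (MvPolynomial (Fin m × Fin m) ℂ)),
    (∀ a : Fin m × Fin m, ((m - n ≤ (a.1 : ℕ) ∧ m - n ≤ (a.2 : ℕ)) ∨ a = (0, 0)) →
      ∀ b : Fin m × Fin m, (q : Matrix (Fin m × Fin m) (Fin m × Fin m) ℂ) b a = if b = a then 1 else 0) →
    (∀ L : Matrix.GeneralLinearGroup (Fin m × Fin m) ℂ,
      let M : Matrix (Fin m × Fin m) (Fin m × Fin m) ℂ := L ;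
      let ess := fun a : Fin m × Fin m => (m - n ≤ (a.1 : ℕ) ∧ m - n ≤ (a.2 : ℕ)) ∨ a = (0, 0) ;
      let rk := fun (a : Fin m × Fin m) => (if ess a then 0 else m * m) + ((a.1 : ℕ) * m + (a.2 : ℕ)) ;
      (∀ a, ess a → ∀ b, M b a = if b = a then 1 else 0) →
      (∀ i j, ¬ ess i → ¬ ess j → M j i ≠ 0 → rk j ≤ rk i) →
      ∀ k ≤ m, ∀ D ∈ J' k,
        linSubst (Fin m × Fin m) ℂ (((q⁻¹ : GL (Fin m × Fin m) ℂ) : Matrix (Fin m × Fin m) (Fin m × Fin m) ℂ) *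
          M * (q : Matrix (Fin m × Fin m) (Fin m × Fin m) ℂ))ᵀ D ∈ J' k) →
    (∀ C : Matrix (Fin m × Fin m) (Fin m × Fin m) ℂ,
      (∀ j i : Fin m × Fin m, C j i ≠ 0 →
        ¬ (((m - n ≤ (j.1 : ℕ) ∧ m - n ≤ (j.2 : ℕ)) ∨ j = (0, 0))) ∧
          (((m - n ≤ (i.1 : ℕ) ∧ m - n ≤ (i.2 : ℕ)) ∨ i = (0, 0)))) →
      ∀ k ≤ m, ∀ D ∈ J' k, linSubst (Fin m × Fin m) ℂ (1 + C) D ∈ J' k) →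
    ∃ R : GL (Fin m × Fin m) ℂ,
      let ess := fun a : Fin m × Fin m => (m - n ≤ (a.1 : ℕ) ∧ m - n ≤ (a.2 : ℕ)) ∨ a = (0, 0) ;
      (∀ a, ess a → ∀ b, (R : Matrix (Fin m × Fin m) (Fin m × Fin m) ℂ) b a = if b = a then 1 else 0) ∧
      (∀ b a, ess b → ¬ ess a → (R : Matrix (Fin m × Fin m) (Fin m × Fin m) ℂ) b a = 0) ∧
      (∀ b a, ¬ ess b → ¬ ess a → (R : Matrix (Fin m × Fin m) (Fin m × Fin m) ℂ) b a =
        (q : Matrix (Fin m × Fin m) (Fin m × Fin m) ℂ) b a) ∧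
      ∀ d : Fin m × Fin m → ℂ, (∀ i, d i ≠ 0) → (∀ a, ess a → d a = 1) →
        ∀ k ≤ m, ∀ D ∈ J' k,
          linSubst (Fin m × Fin m) ℂ (((R⁻¹ : GL (Fin m × Fin m) ℂ) : Matrix (Fin m × Fin m) (Fin m × Fin m) ℂ) *
            Matrix.diagonal d * (R : Matrix (Fin m × Fin m) (Fin m × Fin m) ℂ))ᵀ D ∈ J' k := by
  intro n m _ q J' hP1 hSB hSH
  obtain ⟨R, hRo, hRc, hRu, hR⟩ := snf_stab_cleanBorel n m q J' hP1 hSB hSH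
  refine ⟨R, ?_⟩
  intro ess
  refine ⟨hRo, hRc, hRu, ?_⟩
  intro d hd0 hd1 k hk D hD
  have hdet : (Matrix.diagonal d).det ≠ 0 := by
    rw [Matrix.det_diagonal]
    exact Finset.prod_ne_zero_iff.mpr fun i _ => hd0 i
  have h := hR (Matrix.GeneralLinearGroup.mkOfDetNeZero _ hdet)
  simp only [Matrix.GeneralLinearGroup.val_mkOfDetNeZero] at h
  refine h ?_ ?_ ?_ k hk D hD
  · intro a ha b
    by_cases hba : b = a
    · subst hba
      rw [Matrix.diagonal_apply_eq, if_pos rfl, hd1 b ha]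
    · rw [Matrix.diagonal_apply_ne _ hba, if_neg hba]
  · intro b a hb ha
    rw [Matrix.diagonal_apply_ne]
    rintro rfl
    exact ha hb
  · intro i j _ _ hij
    by_cases hji : j = i
    · subst hji
      exact le_rfl
    · exact (hij (Matrix.diagonal_apply_ne _ hji)).elim

end Summit.ValiantsHypothesis.ValiantsHypothesis.Theorems.BorderApolarityToricWitnessObstructionQP
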